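import Summits.Ventures.HSemireg.WedgeHankelRecurrenceGaussChebyshevPellSequences

/-!
# Venture HSemireg — **COSINE PRODUCTS FOR LUCAS NUMBERS AND PELL SOLUTIONS: `L_n² = ∏_{k<n} (1 + 4cos²((2k+1)π∕2n))`, `L_{2n} = ∏_{k<n} (3 − 2cos((2k+1)π∕2n))`,
# `y_{n+1}(a) = ∏_{k<n} (2a − 2cos((k+1)π∕(n+1)))`, `2x_n(a) = ∏_{k<n} (2a − 2cos((2k+1)π∕2n))`** (`n ≥ 1`; the real factorisations `S_n = ∏ (X − 2cos((k+1)π∕(n+1)))`, `C_n = ∏ (X − 2cos((2k+1)π∕2n))`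
# of N500 evaluated at `i`, `3`, `2a` through N526–N528)

HONEST FRAMING. Part of the Lean index of the computation cell `pub-hsemireg` (seat p10 gen 49, Sunday typer «UNIFORM-IN-n»).  Real and complex evaluation of the polynomial identities of N500 and
N526–N528 (Mathlib `Polynomial.Chebyshev.S ∕ C`, `Nat.fib`, `Pell.xn ∕ yn`); no variety, no cohomology theory, no sheaf, no Ext group and no semiregularity map is constructed here; nothing here says
that HC / HC_CM / HC_AV holds; no Literature fact (unproved `Prop`) is declared or used.  Custodian versions as in `WedgeHankelSiegelIdeal` (1/3).
SOURCES (cited).  N. Garnier, O. Ramaré, *Fibonacci numbers and trigonometric identities*, Fibonacci Quart. 46∕47 (2008∕09) 56–61 (`L_n = ∏_{k=1}^{⌊n∕2⌋} (1 + 4cos²((2k−1)π∕2n))`-type products; the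
square forms below are the unpaired products); T. Koshy, *Fibonacci and Lucas Numbers with Applications* (Wiley 2001), Ch. 17; H. W. Lenstra Jr., *Solving the Pell equation*, Notices AMS 49 (2002).
PROOF TYPED HERE.  N500 `chebyshevS_eq_prod_real`, `chebyshevC_eq_prod_real` (`n ≠ 0`) evaluated at `X = 3` (N526 `chebyshevC_eval_three`), at `X = 2a` (N528 `chebyshevS_eval_eq_pell_yn`,
`chebyshevC_eval_eq_two_mul_pell_xn`), and — after `Polynomial.map (algebraMap ℝ ℂ)` — at `X = i` with `Complex.normSq` (N527 `chebyshevC_eval_complex_I`, `normSq_I_sub_ofReal`).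
DEDUP DISCLOSURE (`rg -n 'prod_cos|4 \\* Real.cos .* \\^ 2' Summits/Ventures/HSemireg`, 2026-09-04): N526 `fib_two_mul_add_two_eq_prod_cos` (`F_{2n+2}`) and N527 `fib_succ_sq_eq_prod_cos` (`F_{n+1}²`) are the
`S`-side statements; the `C`-side (`L_n²`, `L_{2n}`) and the Pell products are new; Mathlib has none; 0 hits for the 6 names below.

WHAT IS IN THE TREE.  N500 `chebyshevS_eq_prod_real`, `chebyshevC_eq_prod_real`; N526 `chebyshevC_eval_three`; N527 `chebyshevC_eval_complex_I`, `normSq_I_sub_ofReal`; N528 `chebyshevS_eval_eq_pell_yn`,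
`chebyshevC_eval_eq_two_mul_pell_xn`; Mathlib `map_C`, `Polynomial.map_prod`, `eval_prod`, `Complex.normSq_*`.
THIS FILE (namespace `Summit.Ventures.HSemireg.Wedge.HankelOuter` continued; CHAINED on N528; 0 definitions):
* §1294 `chebyshevC_complex_eq_prod_cos` (`C_n` over `ℂ`, `n ≠ 0`), **`lucas_sq_eq_prod_cos`** (`(2F_{n+1} − F_n)² = ∏_{k<n} (1 + 4cos²((2k+1)π∕2n))`, `n ≠ 0`), **`lucas_two_mul_eq_prod_cos`**
  (`2F_{2n+1} − F_{2n} = ∏_{k<n} (3 − 2cos((2k+1)π∕2n))`, `n ≠ 0`), **`pell_yn_eq_prod_cos`** (`y_{n+1}(a) = ∏_{k<n} (2a − 2cos((k+1)π∕(n+1)))`), **`two_mul_pell_xn_eq_prod_cos`**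
  (`2x_n(a) = ∏_{k<n} (2a − 2cos((2k+1)π∕2n))`, `n ≠ 0`), **`pell_xn_eq_prod`** (`2x_n(a) = 2ⁿ ∏_{k<n} (a − cos((2k+1)π∕2n))`, i.e. `x_n = 2^{n−1}∏ (a − cos θ_k) = T_n(a)`, `n ≠ 0`).
CAVEATS.  `L_n` is written `2F_{n+1} − F_n`; `n ≠ 0` where `C_0 = 2` has no factorisation.  Nothing Ext-side.  New names only.
-/

open Module Polynomial
open scoped Matrix Polynomial

namespace Summit.Ventures.HSemireg.Wedge.HankelOuter

/-! ## §1294. Cosine products for `L_n²`, `L_{2n}`, `y_n(a)`, `x_n(a)` -/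

/-- `C_n` over `ℂ` factors as `∏_{k<n} (X − 2cos((2k+1)π∕2n))` for `n ≠ 0` (N500 mapped along `ℝ → ℂ`). [this file, §1294] -/
theorem chebyshevC_complex_eq_prod_cos {n : ℕ} (hn : n ≠ 0) :
    Polynomial.Chebyshev.C ℂ (n : ℤ) = ∏ k ∈ Finset.range n, (X - Polynomial.C ((2 * Real.cos ((2 * k + 1) * Real.pi / (2 * n)) : ℝ) : ℂ)) := by
  have h := congrArg (Polynomial.map (algebraMap ℝ ℂ)) (chebyshevC_eq_prod_real hn)
  rw [Polynomial.Chebyshev.map_C, Polynomial.map_prod] at h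
  exact h.trans (Finset.prod_congr rfl fun k _ => by simp)

/-- **`L_n² = (2F_{n+1} − F_n)² = ∏_{k<n} (1 + 4cos²((2k+1)π∕2n))`** for `n ≠ 0` (norm-square of `C_n(i) = iⁿ L_n`). [Garnier–Ramaré 2008; this file, §1294] -/
theorem lucas_sq_eq_prod_cos {n : ℕ} (hn : n ≠ 0) :
    (2 * (Nat.fib (n + 1) : ℝ) - (Nat.fib n : ℝ)) ^ 2 = ∏ k ∈ Finset.range n, (1 + 4 * Real.cos ((2 * k + 1) * Real.pi / (2 * n)) ^ 2) := by
  have h := congrArg (fun p : ℂ[X] => Complex.normSq (p.eval Complex.I)) (chebyshevC_complex_eq_prod_cos hn)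
  have hL : (2 * (Nat.fib (n + 1) : ℂ) - (Nat.fib n : ℂ)) = ((2 * (Nat.fib (n + 1) : ℝ) - (Nat.fib n : ℝ) : ℝ) : ℂ) := by push_cast; ring
  rw [chebyshevC_eval_complex_I, hL, eval_prod, map_mul, map_pow, Complex.normSq_I, one_pow, one_mul, Complex.normSq_ofReal, map_prod] at h
  rw [sq, h]
  refine Finset.prod_congr rfl fun k _ => ?_
  rw [eval_sub, eval_X, eval_C, normSq_I_sub_ofReal]
  ring

/-- **`L_{2n} = 2F_{2n+1} − F_{2n} = ∏_{k<n} (3 − 2cos((2k+1)π∕2n))`** for `n ≠ 0` (`C_n(3) = L_{2n}`, N526). [Koshy 2001, Ch. 17; this file, §1294] -/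
theorem lucas_two_mul_eq_prod_cos {n : ℕ} (hn : n ≠ 0) :
    2 * (Nat.fib (2 * n + 1) : ℝ) - (Nat.fib (2 * n) : ℝ) = ∏ k ∈ Finset.range n, (3 - 2 * Real.cos ((2 * k + 1) * Real.pi / (2 * n))) := by
  rw [← chebyshevC_eval_three (R := ℝ) n, chebyshevC_eq_prod_real hn, eval_prod]
  exact Finset.prod_congr rfl fun k _ => by rw [eval_sub, eval_X, eval_C]

/-- **`y_{n+1}(a) = ∏_{k<n} (2a − 2cos((k+1)π∕(n+1)))`** (`S_n(2a) = y_{n+1}`, N528). [Lenstra 2002; this file, §1294] -/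
theorem pell_yn_eq_prod_cos {a : ℕ} (a1 : 1 < a) (n : ℕ) :
    (Pell.yn a1 (n + 1) : ℝ) = ∏ k ∈ Finset.range n, (2 * (a : ℝ) - 2 * Real.cos ((k + 1) * Real.pi / (n + 1))) := by
  rw [← chebyshevS_eval_eq_pell_yn (R := ℝ) a1 n, chebyshevS_eq_prod_real, eval_prod]
  exact Finset.prod_congr rfl fun k _ => by rw [eval_sub, eval_X, eval_C]

/-- **`2x_n(a) = ∏_{k<n} (2a − 2cos((2k+1)π∕2n))`** for `n ≠ 0` (`C_n(2a) = 2x_n`, N528). [Lenstra 2002; this file, §1294] -/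
theorem two_mul_pell_xn_eq_prod_cos {a : ℕ} (a1 : 1 < a) {n : ℕ} (hn : n ≠ 0) :
    2 * (Pell.xn a1 n : ℝ) = ∏ k ∈ Finset.range n, (2 * (a : ℝ) - 2 * Real.cos ((2 * k + 1) * Real.pi / (2 * n))) := by
  rw [← chebyshevC_eval_eq_two_mul_pell_xn (R := ℝ) a1 n, chebyshevC_eq_prod_real hn, eval_prod]
  exact Finset.prod_congr rfl fun k _ => by rw [eval_sub, eval_X, eval_C]

/-- **`x_n(a) = 2^{n−1} ∏_{k<n} (a − cos((2k+1)π∕2n))`, in the form `2·x_n(a) = 2ⁿ ∏_{k<n} (a − cos((2k+1)π∕2n))`** (`n ≠ 0`; `T_n = 2^{n−1} ∏ (X − cos θ_k)`). [Rivlin 1974, §1.2; this file, §1294] -/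
theorem pell_xn_eq_prod {a : ℕ} (a1 : 1 < a) {n : ℕ} (hn : n ≠ 0) :
    2 * (Pell.xn a1 n : ℝ) = 2 ^ n * ∏ k ∈ Finset.range n, ((a : ℝ) - Real.cos ((2 * k + 1) * Real.pi / (2 * n))) := by
  rw [two_mul_pell_xn_eq_prod_cos a1 hn, show (2 : ℝ) ^ n = ∏ _k ∈ Finset.range n, (2 : ℝ) by rw [Finset.prod_const, Finset.card_range],
    ← Finset.prod_mul_distrib]
  exact Finset.prod_congr rfl fun k _ => by ring

end Summit.Ventures.HSemireg.Wedge.HankelOuter
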